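import Literature.AnabelianGeometry.EtaleTheta.Discharge.Sec5Prop24OfThetaSettingTower
import Literature.AnabelianGeometry.EtaleTheta.Discharge.Sec5PsiPreservesFrobeniusTrivial

/-!
# [EtTh] Thm. 4.4 / Thm. 5.7 at the genuine §5 tower: the §4-package producer WITHOUT the binder «`Ψ` induces `Ψ^bs`»
# (`hΨbs` ⟸ [FrdI] Thm. 3.4 (v)) — `h44 : Thm44Hyp S S` ⟸ {Thm. 5.2 hypotheses, «`Φ` non-dilating», «`D = B^temp(X)[𝒟]`», Prop. 2.4}
# (pp. 319–320, 322–323, 329–330 / PDF pp. 93–94, 96–97, 103–104; [FrdI] Thm. 3.4 (v) p.63)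

Mochizuki, *The étale theta function and its Frobenioid-theoretic manifestations*, Publ. RIMS **45** (2009), Thm. 4.4 p.319–320
(PDF pp.93–94): «Suppose that `Ψ : C₁ ⥲ C₂` is an equivalence of categories which induces [cf. Theorem 3.7, (i), (ii); Remark 3.7.2;
[Mzk17], Theorem 3.4, (v)] an equivalence `Ψ^bs : D₁ ⥲ D₂` that maps `A^bs_{⊙,1}` to an isomorph [cf. §0] of `A^bs_{⊙,2}`.» (p.319 / PDF
p.93, verbatim; «1-compatible» is print's word for `Ψ^birat` in clause (ii), p.320 — v2: quote normalised after abc-iut-aud-8's INFO-1 on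
p456178, comment-only) [cite: MochizukiEtTh2009, Thm 4.4 p.319–320 (PDF pp.93–94)];
S. Mochizuki, *The geometry of Frobenioids I* (2008), Thm. 3.4 (v) p.63: «the horizontal arrows are equivalences»
[cite: MochizukiFrdI2008, Thm. 3.4 (v) p.63].

abc-iut cell, layer L2, seat abc-iut-w5-d123 (gen 5); self-named L-F [EtTh] row «hΨbs OF THE §4-PACKAGE PRODUCER AT THE GENUINE
TOWER ⟸ [FrdI] Thm. 3.4 (v)» (abc-iut-L2-lead tokens of record: «h44 ⟸ {hnd, hshape (or base-equivalence), hΨbs, hP24} at general VD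
(p446962)», «at the Setting h44 ⟸ {hnd, hshape, hΨbs, h218i (F-0620), h15 (F-0591), L}» (R474)).  PROOF-ONLY (0 definitions, 0 new
named facts; nothing landed is edited or restated — every producer is CONSUMED BY NAME).

THE POINT.  abc-iut-w4-d008's §4-package producer `BiKummerSetting.exists_thm44Hyp_mkOfConnectedTemperoidYddTower` (p446962, FILE 5) —
the `h44 : Thm44Hyp S S` binder of every Thm. 5.7 closer at `S := mkOfConnectedTemperoidYddTower X tf hZ hP NH 𝒯 ιX` over the genuine
connected base `B^temp(Π^tp_X)⁰` — takes `hΨbs : ∃ Ψbs : D ≌ D, Nonempty (Base ⋙ Ψbs ≅ Ψ ⋙ Base)` («`Ψ` induces `Ψ^bs`») as a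
HYPOTHESIS.  In print this is not a hypothesis but [FrdI] Thm. 3.4 (v), and the tree PROVES it: abc-iut-L1-d4's `PreFrobenioid.psiBase` /
`psiBase_isEquivalence` / `psiBaseSquare`, packaged for any [EtTh] §4 setting over a slim base of FSM-type by abc-iut-w5-d013's
`BiKummerSetting.exists_psiBase_frobeniusType_degFr` (p445745; at `mkOfConnectedTemperoid` its
`exists_baseEquivalence_compat_mkOfConnectedTemperoid`).  Over `B^temp(Π^tp_X)⁰` «FSM-type» (`connectedPart_isOfFSMType`), «slim»
(`isSlim_connectedPart`) and «a non-group-like object» (Def. 3.6 (ii)(b), abc-iut-w5-d123's `exists_not_isGroupLikeObj`) are THEOREMS, so: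
* `hΨbs_mkOfConnectedTemperoidYddTower` — the binder `hΨbs` of FILE 5 in its EXACT shape, from {`h` (the [FrdI] Thm. 5.2 hypotheses of the
  Def. 3.6 (ii) data), `hnd` («`Φ` non-dilating», tree form)} — for EVERY `Ψ`;
* **`exists_thm44Hyp_mkOfConnectedTemperoidYddTower_of_model`** — `h44` ⟸ {`h`, `hnd`, `hndV` (the vocabulary form FILE 5 reads), `hshape`,
  `hP24`}: `hΨbs` GONE; `…_of_base_isEquivalence` — `hshape` gone too when `tf.base` is an equivalence (abc-iut-w4-d008's FILE 3);
* **`…_of_model_treeVocab` / `…_of_model_treeVocabWeak`** — at the canonical vocabulary pairs (`treeMonoidVocab(Weak)`, `treeCatVocab`) the two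
  non-dilating forms coincide (`isNonDilatingOn_iff_pull(_weak)`) and `h` ⟸ «`B` a monoid» (`hypotheses_treeCatVocab`):
  `h44` ⟸ {`hBmon`, `hndV`, `hshape`, `hP24`} — print's list («`B` monoid on `D`» [FrdI] Thm. 5.2, «`Φ` non-dilating» Thm. 4.4, «`D :=
  B^temp(X^log)[𝒟]`» §5 p.322, Prop. 2.4);
* **`exists_thm44Hyp_ofThetaSettingYddTower_of_model_of_cor218_i` / `…_treeVocab(Weak)_of_cor218_i`** — AT THE §1 SETTING (`Π^tp_X̲̲`,
  `Cu.thetaEnvTower τ hC hS`, `id`) with `hP24` ⟸ F-0620 as well (abc-iut-w5-d123's `hP24_thetaEnvTower_of_cor218_i`, p452318):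
  `h44` ⟸ {`hBmon`, `hndV`, `hshape`, `h218i` (F-0620), `h15` (F-0591), `L`} at the canonical vocabularies.
HONEST FRAMING: kernel-checked composition of landed theorems ([FrdI] Thm. 3.4 (v) is PROVED in the tree by abc-iut-L1; [EtTh] Cor. 2.18 (i)
and Prop. 1.5 (iii) enter as FACT-policy assumption labels `h218i`, `h15`); no instance of `TemperedFrobenioid T₀ (ConnectedPart (BTemp Π))
VD` for an actual curve is constructed here; nothing asserts any result of [EtTh] unconditionally; no side is taken on [IUTchIII] Cor. 3.12. -/

-- `S.base` is `PreFrobenioid.baseFunctor S.F` only at default transparency (as in abc-iut-w5-d013's `Sec5PsiPreservesFrobeniusTrivial`).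
set_option backward.isDefEq.respectTransparency false

noncomputable section

namespace Literature.AnabelianGeometry.EtaleTheta

open CategoryTheory Opposite Literature.AlgebraicGeometry.Frobenioids Literature.AnabelianGeometry.SemiGraphs

namespace BiKummerSetting

universe u₀ v₀ w

/-! ## The genuine connected tower, general vocabularies `V`, `VD` -/

section Tower

variable {K : Type u₀} [Field K] (X : SemiGraphs.TemperedArithmeticGroup.{u₀} K) {D₀ : Type u₀} [Category.{v₀} D₀]
  {V : FrdIMonoidStub.{w}} {T₀ : RealifiedDivisorMonoids (D₀ := D₀) V}
  {VD : FrdICatStub.{u₀ + 1, u₀, w} (ConnectedPart (BTemp X.Pi))}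
  (tf : TemperedFrobenioid T₀ (ConnectedPart (BTemp X.Pi)) VD) (hZ : tf.monoidType = MonoidType.Z)
  (hP : ∀ A : (ConnectedPart (BTemp X.Pi))ᵒᵖ, IsPerfect (tf.Φ.carrier A))
  (NH : Subgroup (Field.absoluteGaloisGroup K) → tf.category → ℕ+ → Prop)
  {E : Set ℕ+} (𝒯 : ThetaEnvTower.{max u₀ w} E) (ιX : 𝒯.PiX ≃ₜ* X.Pi)

/-- **«`Ψ` induces `Ψ^bs`» over `B^temp(Π^tp_X)⁰` is a THEOREM** — the binder `hΨbs` of abc-iut-w4-d008's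
`exists_thm44Hyp_mkOfConnectedTemperoidYddTower` in its exact shape, for EVERY self-equivalence `Ψ`: [FrdI] Thm. 3.4 (v) (abc-iut-L1-d4's
`psiBase`, through abc-iut-w5-d013's `exists_psiBase_frobeniusType_degFr`) at the base `B^temp(Π^tp_X)⁰`, which is of FSM-type
(`connectedPart_isOfFSMType`) and slim (`isSlim_connectedPart`); the non-group-like object is Def. 3.6 (ii)(b) (`exists_not_isGroupLikeObj`).
Inputs: `h` ([FrdI] Thm. 5.2 hypotheses of the Def. 3.6 (ii) data) and `hnd` («`Φ` non-dilating»).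
[cite: MochizukiEtTh2009, Thm 4.4 p.319–320 (PDF pp.93–94)] [cite: MochizukiFrdI2008, Thm. 3.4 (v) p.63] -/
theorem hΨbs_mkOfConnectedTemperoidYddTower (h : ModelFrobenioid.Hypotheses tf.divisorMonoid tf.ratFnFunctor)
    (hnd : IsNonDilatingOn tf.divisorMonoid) (Ψ : tf.category ≌ tf.category) :
    ∃ Ψbs : ConnectedPart (BTemp X.Pi) ≌ ConnectedPart (BTemp X.Pi),
      Nonempty ((mkOfConnectedTemperoidYddTower X tf hZ hP NH 𝒯 ιX).base ⋙ Ψbs.functor ≅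
        Ψ.functor ⋙ (mkOfConnectedTemperoidYddTower X tf hZ hP NH 𝒯 ιX).base) := by
  obtain ⟨Ψbs, hΨbs, eΨ, -, -, -⟩ :=
    (mkOfConnectedTemperoidYddTower X tf hZ hP NH 𝒯 ιX).exists_psiBase_frobeniusType_degFr h
      QuasiTemperoid.BTempConnected.connectedPart_isOfFSMType (TemperedArithmeticGroup.isSlim_connectedPart X) hnd
      (mkOfConnectedTemperoidYddTower X tf hZ hP NH 𝒯 ιX).exists_not_isGroupLikeObj Ψ
  exact ⟨Ψbs.asEquivalence, ⟨eΨ.symm⟩⟩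

/-- **The §4 package `h44 : Thm44Hyp S S` at the genuine connected tower WITHOUT `hΨbs`**: abc-iut-w4-d008's
`exists_thm44Hyp_mkOfConnectedTemperoidYddTower` (p446962) with «`Ψ` induces `Ψ^bs`» supplied by `hΨbs_mkOfConnectedTemperoidYddTower` —
`h44` ⟸ {`h`, `hnd` (tree form), `hndV` (the vocabulary-`V` form the package records), `hshape` («`D = B^temp(X)[𝒟]`»), `hP24` (Prop. 2.4:
`∀γ`-stability of `Π^tp_Ÿ`)}, for EVERY `Ψ`.  [cite: MochizukiEtTh2009, Thm 4.4 p.319–320 (PDF pp.93–94); Thm 5.7 p.329–330 (PDF pp.103–104)] -/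
theorem exists_thm44Hyp_mkOfConnectedTemperoidYddTower_of_model (Ψ : tf.category ≌ tf.category)
    (h : ModelFrobenioid.Hypotheses tf.divisorMonoid tf.ratFnFunctor) (hnd : IsNonDilatingOn tf.divisorMonoid)
    (hndV : ∀ (A : (ConnectedPart (BTemp X.Pi))ᵒᵖ) (φ : A ⟶ A), V.IsNonDilating (tf.Φ.carrier A) (tf.Φ.pull φ))
    (hshape : tf.base.Full ∧ tf.base.Faithful ∧
      ∃ 𝒟 : D₀, ∀ Y : D₀, (∃ A : ConnectedPart (BTemp X.Pi), Nonempty (tf.base.obj A ≅ Y)) ↔ Nonempty (Y ⟶ 𝒟))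
    (hP24 : ∀ γ : 𝒯.PiX ≃ₜ* 𝒯.PiX, 𝒯.PiYdd.map γ.toMulEquiv.toMonoidHom = 𝒯.PiYdd) :
    ∃ hh : Thm44Hyp (mkOfConnectedTemperoidYddTower X tf hZ hP NH 𝒯 ιX) (mkOfConnectedTemperoidYddTower X tf hZ hP NH 𝒯 ιX),
      hh.Ψ = Ψ :=
  exists_thm44Hyp_mkOfConnectedTemperoidYddTower X tf hZ hP NH 𝒯 ιX Ψ hndV hshape
    (hΨbs_mkOfConnectedTemperoidYddTower X tf hZ hP NH 𝒯 ιX h hnd Ψ) hP24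

/-- The same with `hshape` DISCHARGED as well when the Def. 3.3 reference functor `tf.base` is an equivalence (abc-iut-w4-d008's
`hshape_of_base_isEquivalence`): `h44` ⟸ {`h`, `hnd`, `hndV`, `hP24`}.  [cite: MochizukiEtTh2009, Thm 5.7 p.329–330 (PDF pp.103–104)] -/
theorem exists_thm44Hyp_mkOfConnectedTemperoidYddTower_of_model_of_base_isEquivalence [tf.base.IsEquivalence]
    (Ψ : tf.category ≌ tf.category) (h : ModelFrobenioid.Hypotheses tf.divisorMonoid tf.ratFnFunctor)
    (hnd : IsNonDilatingOn tf.divisorMonoid)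
    (hndV : ∀ (A : (ConnectedPart (BTemp X.Pi))ᵒᵖ) (φ : A ⟶ A), V.IsNonDilating (tf.Φ.carrier A) (tf.Φ.pull φ))
    (hP24 : ∀ γ : 𝒯.PiX ≃ₜ* 𝒯.PiX, 𝒯.PiYdd.map γ.toMulEquiv.toMonoidHom = 𝒯.PiYdd) :
    ∃ hh : Thm44Hyp (mkOfConnectedTemperoidYddTower X tf hZ hP NH 𝒯 ιX) (mkOfConnectedTemperoidYddTower X tf hZ hP NH 𝒯 ιX),
      hh.Ψ = Ψ :=
  exists_thm44Hyp_mkOfConnectedTemperoidYddTower_of_model X tf hZ hP NH 𝒯 ιX Ψ h hnd hndV (hshape_of_base_isEquivalence X tf) hP24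

end Tower

/-! ## The genuine connected tower at the canonical vocabularies: `h44` ⟸ {`hBmon`, `hndV`, `hshape`, `hP24`} -/

section TreeVocab

variable {K : Type u₀} [Field K] (X : SemiGraphs.TemperedArithmeticGroup.{u₀} K) {D₀ : Type u₀} [Category.{v₀} D₀]
  {T₀ : RealifiedDivisorMonoids (D₀ := D₀) treeMonoidVocab.{w}}
  {IsRational IsStrictlyRational : ((ConnectedPart (BTemp X.Pi))ᵒᵖ ⥤ CommMonCat.{w}) → Prop}
  (tf : TemperedFrobenioid T₀ (ConnectedPart (BTemp X.Pi)) (treeCatVocab (ConnectedPart (BTemp X.Pi)) IsRational IsStrictlyRational))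
  (hZ : tf.monoidType = MonoidType.Z) (hP : ∀ A : (ConnectedPart (BTemp X.Pi))ᵒᵖ, IsPerfect (tf.Φ.carrier A))
  (NH : Subgroup (Field.absoluteGaloisGroup K) → tf.category → ℕ+ → Prop)
  {E : Set ℕ+} (𝒯 : ThetaEnvTower.{max u₀ w} E) (ιX : 𝒯.PiX ≃ₜ* X.Pi)

/-- **`h44` at the genuine connected tower, canonical vocabularies (`treeMonoidVocab`, `treeCatVocab`)**: the [FrdI] Thm. 5.2 hypotheses
hold modulo «`B` a monoid on `D`» (`hypotheses_treeCatVocab`) and «`Φ` non-dilating» has ONE form (`isNonDilatingOn_iff_pull`) —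
`h44` ⟸ {`hBmon`, `hndV`, `hshape`, `hP24`}, for EVERY `Ψ`.  [cite: MochizukiEtTh2009, Thm 4.4 p.319–320 (PDF pp.93–94); §5 p.322–323 (PDF pp.96–97)] -/
theorem exists_thm44Hyp_mkOfConnectedTemperoidYddTower_of_model_treeVocab (Ψ : tf.category ≌ tf.category)
    (hBmon : IsMonoidOn tf.ratFnFunctor)
    (hndV : ∀ (A : (ConnectedPart (BTemp X.Pi))ᵒᵖ) (φ : A ⟶ A), treeMonoidVocab.{w}.IsNonDilating (tf.Φ.carrier A) (tf.Φ.pull φ))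
    (hshape : tf.base.Full ∧ tf.base.Faithful ∧
      ∃ 𝒟 : D₀, ∀ Y : D₀, (∃ A : ConnectedPart (BTemp X.Pi), Nonempty (tf.base.obj A ≅ Y)) ↔ Nonempty (Y ⟶ 𝒟))
    (hP24 : ∀ γ : 𝒯.PiX ≃ₜ* 𝒯.PiX, 𝒯.PiYdd.map γ.toMulEquiv.toMonoidHom = 𝒯.PiYdd) :
    ∃ hh : Thm44Hyp (mkOfConnectedTemperoidYddTower X tf hZ hP NH 𝒯 ιX) (mkOfConnectedTemperoidYddTower X tf hZ hP NH 𝒯 ιX),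
      hh.Ψ = Ψ :=
  exists_thm44Hyp_mkOfConnectedTemperoidYddTower_of_model X tf hZ hP NH 𝒯 ιX Ψ (tf.hypotheses_treeCatVocab hBmon)
    (tf.isNonDilatingOn_iff_pull.mpr hndV) hndV hshape hP24

/-- The same with `hshape` discharged when `tf.base` is an equivalence: `h44` ⟸ {`hBmon`, `hndV`, `hP24`}.
[cite: MochizukiEtTh2009, Thm 5.7 p.329–330 (PDF pp.103–104)] -/
theorem exists_thm44Hyp_mkOfConnectedTemperoidYddTower_of_model_treeVocab_of_base_isEquivalence [tf.base.IsEquivalence]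
    (Ψ : tf.category ≌ tf.category) (hBmon : IsMonoidOn tf.ratFnFunctor)
    (hndV : ∀ (A : (ConnectedPart (BTemp X.Pi))ᵒᵖ) (φ : A ⟶ A), treeMonoidVocab.{w}.IsNonDilating (tf.Φ.carrier A) (tf.Φ.pull φ))
    (hP24 : ∀ γ : 𝒯.PiX ≃ₜ* 𝒯.PiX, 𝒯.PiYdd.map γ.toMulEquiv.toMonoidHom = 𝒯.PiYdd) :
    ∃ hh : Thm44Hyp (mkOfConnectedTemperoidYddTower X tf hZ hP NH 𝒯 ιX) (mkOfConnectedTemperoidYddTower X tf hZ hP NH 𝒯 ιX),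
      hh.Ψ = Ψ :=
  exists_thm44Hyp_mkOfConnectedTemperoidYddTower_of_model_treeVocab X tf hZ hP NH 𝒯 ιX Ψ hBmon hndV
    (hshape_of_base_isEquivalence X tf) hP24

end TreeVocab

section TreeVocabWeak

variable {K : Type u₀} [Field K] (X : SemiGraphs.TemperedArithmeticGroup.{u₀} K) {D₀ : Type u₀} [Category.{v₀} D₀]
  {T₀ : RealifiedDivisorMonoids (D₀ := D₀) treeMonoidVocabWeak.{w}}
  {IsRational IsStrictlyRational : ((ConnectedPart (BTemp X.Pi))ᵒᵖ ⥤ CommMonCat.{w}) → Prop}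
  (tf : TemperedFrobenioid T₀ (ConnectedPart (BTemp X.Pi)) (treeCatVocab (ConnectedPart (BTemp X.Pi)) IsRational IsStrictlyRational))
  (hZ : tf.monoidType = MonoidType.Z) (hP : ∀ A : (ConnectedPart (BTemp X.Pi))ᵒᵖ, IsPerfect (tf.Φ.carrier A))
  (NH : Subgroup (Field.absoluteGaloisGroup K) → tf.category → ℕ+ → Prop)
  {E : Set ℕ+} (𝒯 : ThetaEnvTower.{max u₀ w} E) (ιX : 𝒯.PiX ≃ₜ* X.Pi)

/-- **`h44` at the genuine connected tower, WEAK canonical vocabularies (`treeMonoidVocabWeak`, `treeCatVocab`)** (abc-iut-L2-d2's reading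
at tempered coverings with infinitely many special-fibre components; `isNonDilatingOn_iff_pull_weak`): `h44` ⟸ {`hBmon`, `hndV`, `hshape`,
`hP24`}, for EVERY `Ψ`.  [cite: MochizukiEtTh2009, Thm 4.4 p.319–320 (PDF pp.93–94); §5 p.322–323 (PDF pp.96–97)] -/
theorem exists_thm44Hyp_mkOfConnectedTemperoidYddTower_of_model_treeVocabWeak (Ψ : tf.category ≌ tf.category)
    (hBmon : IsMonoidOn tf.ratFnFunctor)
    (hndV : ∀ (A : (ConnectedPart (BTemp X.Pi))ᵒᵖ) (φ : A ⟶ A),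
      treeMonoidVocabWeak.{w}.IsNonDilating (tf.Φ.carrier A) (tf.Φ.pull φ))
    (hshape : tf.base.Full ∧ tf.base.Faithful ∧
      ∃ 𝒟 : D₀, ∀ Y : D₀, (∃ A : ConnectedPart (BTemp X.Pi), Nonempty (tf.base.obj A ≅ Y)) ↔ Nonempty (Y ⟶ 𝒟))
    (hP24 : ∀ γ : 𝒯.PiX ≃ₜ* 𝒯.PiX, 𝒯.PiYdd.map γ.toMulEquiv.toMonoidHom = 𝒯.PiYdd) :
    ∃ hh : Thm44Hyp (mkOfConnectedTemperoidYddTower X tf hZ hP NH 𝒯 ιX) (mkOfConnectedTemperoidYddTower X tf hZ hP NH 𝒯 ιX),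
      hh.Ψ = Ψ :=
  exists_thm44Hyp_mkOfConnectedTemperoidYddTower_of_model X tf hZ hP NH 𝒯 ιX Ψ (tf.hypotheses_treeCatVocab hBmon)
    (tf.isNonDilatingOn_iff_pull_weak.mpr hndV) hndV hshape hP24

/-- The same with `hshape` discharged when `tf.base` is an equivalence: `h44` ⟸ {`hBmon`, `hndV`, `hP24`}.
[cite: MochizukiEtTh2009, Thm 5.7 p.329–330 (PDF pp.103–104)] -/
theorem exists_thm44Hyp_mkOfConnectedTemperoidYddTower_of_model_treeVocabWeak_of_base_isEquivalence [tf.base.IsEquivalence]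
    (Ψ : tf.category ≌ tf.category) (hBmon : IsMonoidOn tf.ratFnFunctor)
    (hndV : ∀ (A : (ConnectedPart (BTemp X.Pi))ᵒᵖ) (φ : A ⟶ A),
      treeMonoidVocabWeak.{w}.IsNonDilating (tf.Φ.carrier A) (tf.Φ.pull φ))
    (hP24 : ∀ γ : 𝒯.PiX ≃ₜ* 𝒯.PiX, 𝒯.PiYdd.map γ.toMulEquiv.toMonoidHom = 𝒯.PiYdd) :
    ∃ hh : Thm44Hyp (mkOfConnectedTemperoidYddTower X tf hZ hP NH 𝒯 ιX) (mkOfConnectedTemperoidYddTower X tf hZ hP NH 𝒯 ιX),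
      hh.Ψ = Ψ :=
  exists_thm44Hyp_mkOfConnectedTemperoidYddTower_of_model_treeVocabWeak X tf hZ hP NH 𝒯 ιX Ψ hBmon hndV
    (hshape_of_base_isEquivalence X tf) hP24

end TreeVocabWeak

/-! ## At the §1 Setting (`Π^tp_X̲̲`, `Cu.thetaEnvTower τ hC hS`, `id`): `hΨbs` gone AND `hP24` ⟸ F-0620 -/

section Setting

variable {p : ℕ} [Fact p.Prime] {DS : ThetaSetting p} {ES : DS.EtaleThetaData} {l' : ℕ} (Cu : ES.DoubleUnderline l')
  {e' : DS.toTemperedCurve.GroupLevelData} {Es : Set ℕ+} (τ : DS.CyclotomeTower l' Es) (hC : DS.Compat) (hS : DS.Sec2Hyps)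
  {D₀ : Type} [Category.{v₀} D₀] {V : FrdIMonoidStub.{0}} {T₀ : RealifiedDivisorMonoids (D₀ := D₀) V}
  {VD : FrdICatStub.{1, 0, 0} (ConnectedPart (BTemp (Cu.temperedArithmeticGroup e').Pi))}
  (tf : TemperedFrobenioid T₀ (ConnectedPart (BTemp (Cu.temperedArithmeticGroup e').Pi)) VD) (hZ : tf.monoidType = MonoidType.Z)
  (hP : ∀ A : (ConnectedPart (BTemp (Cu.temperedArithmeticGroup e').Pi))ᵒᵖ, IsPerfect (tf.Φ.carrier A))
  (NH : Subgroup (Field.absoluteGaloisGroup DS.K) → tf.category → ℕ+ → Prop)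

/-- **The §4 package `h44` AT THE SETTING without `hΨbs`, with `hP24` ⟸ the frozen FACT Cor. 2.18 (i)** (F-0620): abc-iut-w5-d123's
`exists_thm44Hyp_ofThetaSettingYddTower_of_cor218_i` (p453134) fed with `hΨbs_mkOfConnectedTemperoidYddTower` — `h44` ⟸ {`h`, `hnd`, `hndV`,
`hshape`, `h218i` (F-0620), `h15` (F-0591), `L`}, for EVERY `Ψ`; general vocabularies `V`, `VD`.
[cite: MochizukiEtTh2009, Thm 4.4 p.319–320 (PDF pp.93–94); Cor 2.18 (i) p.285–286 (PDF pp.59–60)] [cite: MochizukiFrdI2008, Thm. 3.4 (v) p.63] -/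
theorem exists_thm44Hyp_ofThetaSettingYddTower_of_model_of_cor218_i (Ψ : tf.category ≌ tf.category)
    (h : ModelFrobenioid.Hypotheses tf.divisorMonoid tf.ratFnFunctor) (hnd : IsNonDilatingOn tf.divisorMonoid)
    (hndV : ∀ (A : (ConnectedPart (BTemp (Cu.temperedArithmeticGroup e').Pi))ᵒᵖ) (φ : A ⟶ A),
      V.IsNonDilating (tf.Φ.carrier A) (tf.Φ.pull φ))
    (hshape : tf.base.Full ∧ tf.base.Faithful ∧
      ∃ 𝒟 : D₀, ∀ Y : D₀, (∃ A : ConnectedPart (BTemp (Cu.temperedArithmeticGroup e').Pi), Nonempty (tf.base.obj A ≅ Y)) ↔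
        Nonempty (Y ⟶ 𝒟))
    {N' : ℕ+} (μ' : DS.CyclotomeMod l' N') (h15 : DS.Prop15iii ES hC) (L : Cu.CuspLabels)
    (h218i : (Cu.rigidData μ' hC hS h15 L).Cor218_i) :
    ∃ hh : Thm44Hyp
        (mkOfConnectedTemperoidYddTower (Cu.temperedArithmeticGroup e') tf hZ hP NH (Cu.thetaEnvTower τ hC hS)
          (ContinuousMulEquiv.refl _))
        (mkOfConnectedTemperoidYddTower (Cu.temperedArithmeticGroup e') tf hZ hP NH (Cu.thetaEnvTower τ hC hS)
          (ContinuousMulEquiv.refl _)),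
      hh.Ψ = Ψ :=
  exists_thm44Hyp_ofThetaSettingYddTower_of_cor218_i Cu τ hC hS tf hZ hP NH Ψ hndV hshape
    (hΨbs_mkOfConnectedTemperoidYddTower (Cu.temperedArithmeticGroup e') tf hZ hP NH (Cu.thetaEnvTower τ hC hS)
      (ContinuousMulEquiv.refl _) h hnd Ψ) μ' h15 L h218i

/-- The same with `hshape` discharged when `tf.base` is an equivalence: AT THE SETTING `h44` ⟸ {`h`, `hnd`, `hndV`, `h218i` (F-0620),
`h15` (F-0591), `L`}.  [cite: MochizukiEtTh2009, Thm 5.7 p.329–330 (PDF pp.103–104); Cor 2.18 (i) p.285–286 (PDF pp.59–60)] -/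
theorem exists_thm44Hyp_ofThetaSettingYddTower_of_model_of_cor218_i_of_base_isEquivalence [tf.base.IsEquivalence]
    (Ψ : tf.category ≌ tf.category) (h : ModelFrobenioid.Hypotheses tf.divisorMonoid tf.ratFnFunctor)
    (hnd : IsNonDilatingOn tf.divisorMonoid)
    (hndV : ∀ (A : (ConnectedPart (BTemp (Cu.temperedArithmeticGroup e').Pi))ᵒᵖ) (φ : A ⟶ A),
      V.IsNonDilating (tf.Φ.carrier A) (tf.Φ.pull φ))
    {N' : ℕ+} (μ' : DS.CyclotomeMod l' N') (h15 : DS.Prop15iii ES hC) (L : Cu.CuspLabels)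
    (h218i : (Cu.rigidData μ' hC hS h15 L).Cor218_i) :
    ∃ hh : Thm44Hyp
        (mkOfConnectedTemperoidYddTower (Cu.temperedArithmeticGroup e') tf hZ hP NH (Cu.thetaEnvTower τ hC hS)
          (ContinuousMulEquiv.refl _))
        (mkOfConnectedTemperoidYddTower (Cu.temperedArithmeticGroup e') tf hZ hP NH (Cu.thetaEnvTower τ hC hS)
          (ContinuousMulEquiv.refl _)),
      hh.Ψ = Ψ :=
  exists_thm44Hyp_ofThetaSettingYddTower_of_model_of_cor218_i Cu τ hC hS tf hZ hP NH Ψ h hnd hndV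
    (hshape_of_base_isEquivalence (Cu.temperedArithmeticGroup e') tf) μ' h15 L h218i

end Setting

section SettingTreeVocab

variable {p : ℕ} [Fact p.Prime] {DS : ThetaSetting p} {ES : DS.EtaleThetaData} {l' : ℕ} (Cu : ES.DoubleUnderline l')
  {e' : DS.toTemperedCurve.GroupLevelData} {Es : Set ℕ+} (τ : DS.CyclotomeTower l' Es) (hC : DS.Compat) (hS : DS.Sec2Hyps)
  {D₀ : Type} [Category.{v₀} D₀] {T₀ : RealifiedDivisorMonoids (D₀ := D₀) treeMonoidVocab.{0}}
  {IsRational IsStrictlyRational : ((ConnectedPart (BTemp (Cu.temperedArithmeticGroup e').Pi))ᵒᵖ ⥤ CommMonCat.{0}) → Prop}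
  (tf : TemperedFrobenioid T₀ (ConnectedPart (BTemp (Cu.temperedArithmeticGroup e').Pi))
    (treeCatVocab (ConnectedPart (BTemp (Cu.temperedArithmeticGroup e').Pi)) IsRational IsStrictlyRational))
  (hZ : tf.monoidType = MonoidType.Z)
  (hP : ∀ A : (ConnectedPart (BTemp (Cu.temperedArithmeticGroup e').Pi))ᵒᵖ, IsPerfect (tf.Φ.carrier A))
  (NH : Subgroup (Field.absoluteGaloisGroup DS.K) → tf.category → ℕ+ → Prop)

/-- **`h44` AT THE SETTING, canonical vocabularies (`treeMonoidVocab`, `treeCatVocab`)**: `h44` ⟸ {`hBmon` («`B` a monoid», [FrdI] Thm. 5.2),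
`hndV` («`Φ` non-dilating», Thm. 4.4), `hshape` («`D = B^temp(X)[𝒟]`», §5 p.322), `h218i` (F-0620), `h15` (F-0591), `L`} — every other
clause of the §4 package at the Setting is a theorem of the tree.
[cite: MochizukiEtTh2009, Thm 4.4 p.319–320 (PDF pp.93–94); Cor 2.18 (i) p.285–286 (PDF pp.59–60)] [cite: MochizukiFrdI2008, Thm. 3.4 (v) p.63] -/
theorem exists_thm44Hyp_ofThetaSettingYddTower_of_model_treeVocab_of_cor218_i (Ψ : tf.category ≌ tf.category)
    (hBmon : IsMonoidOn tf.ratFnFunctor)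
    (hndV : ∀ (A : (ConnectedPart (BTemp (Cu.temperedArithmeticGroup e').Pi))ᵒᵖ) (φ : A ⟶ A),
      treeMonoidVocab.{0}.IsNonDilating (tf.Φ.carrier A) (tf.Φ.pull φ))
    (hshape : tf.base.Full ∧ tf.base.Faithful ∧
      ∃ 𝒟 : D₀, ∀ Y : D₀, (∃ A : ConnectedPart (BTemp (Cu.temperedArithmeticGroup e').Pi), Nonempty (tf.base.obj A ≅ Y)) ↔
        Nonempty (Y ⟶ 𝒟))
    {N' : ℕ+} (μ' : DS.CyclotomeMod l' N') (h15 : DS.Prop15iii ES hC) (L : Cu.CuspLabels)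
    (h218i : (Cu.rigidData μ' hC hS h15 L).Cor218_i) :
    ∃ hh : Thm44Hyp
        (mkOfConnectedTemperoidYddTower (Cu.temperedArithmeticGroup e') tf hZ hP NH (Cu.thetaEnvTower τ hC hS)
          (ContinuousMulEquiv.refl _))
        (mkOfConnectedTemperoidYddTower (Cu.temperedArithmeticGroup e') tf hZ hP NH (Cu.thetaEnvTower τ hC hS)
          (ContinuousMulEquiv.refl _)),
      hh.Ψ = Ψ :=
  exists_thm44Hyp_ofThetaSettingYddTower_of_model_of_cor218_i Cu τ hC hS tf hZ hP NH Ψ (tf.hypotheses_treeCatVocab hBmon)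
    (tf.isNonDilatingOn_iff_pull.mpr hndV) hndV hshape μ' h15 L h218i

end SettingTreeVocab

section SettingTreeVocabWeak

variable {p : ℕ} [Fact p.Prime] {DS : ThetaSetting p} {ES : DS.EtaleThetaData} {l' : ℕ} (Cu : ES.DoubleUnderline l')
  {e' : DS.toTemperedCurve.GroupLevelData} {Es : Set ℕ+} (τ : DS.CyclotomeTower l' Es) (hC : DS.Compat) (hS : DS.Sec2Hyps)
  {D₀ : Type} [Category.{v₀} D₀] {T₀ : RealifiedDivisorMonoids (D₀ := D₀) treeMonoidVocabWeak.{0}}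
  {IsRational IsStrictlyRational : ((ConnectedPart (BTemp (Cu.temperedArithmeticGroup e').Pi))ᵒᵖ ⥤ CommMonCat.{0}) → Prop}
  (tf : TemperedFrobenioid T₀ (ConnectedPart (BTemp (Cu.temperedArithmeticGroup e').Pi))
    (treeCatVocab (ConnectedPart (BTemp (Cu.temperedArithmeticGroup e').Pi)) IsRational IsStrictlyRational))
  (hZ : tf.monoidType = MonoidType.Z)
  (hP : ∀ A : (ConnectedPart (BTemp (Cu.temperedArithmeticGroup e').Pi))ᵒᵖ, IsPerfect (tf.Φ.carrier A))
  (NH : Subgroup (Field.absoluteGaloisGroup DS.K) → tf.category → ℕ+ → Prop)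

/-- **`h44` AT THE SETTING, WEAK canonical vocabularies (`treeMonoidVocabWeak`, `treeCatVocab`)**: `h44` ⟸ {`hBmon`, `hndV`, `hshape`,
`h218i` (F-0620), `h15` (F-0591), `L`}.
[cite: MochizukiEtTh2009, Thm 4.4 p.319–320 (PDF pp.93–94); Cor 2.18 (i) p.285–286 (PDF pp.59–60)] [cite: MochizukiFrdI2008, Thm. 3.4 (v) p.63] -/
theorem exists_thm44Hyp_ofThetaSettingYddTower_of_model_treeVocabWeak_of_cor218_i (Ψ : tf.category ≌ tf.category)
    (hBmon : IsMonoidOn tf.ratFnFunctor)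
    (hndV : ∀ (A : (ConnectedPart (BTemp (Cu.temperedArithmeticGroup e').Pi))ᵒᵖ) (φ : A ⟶ A),
      treeMonoidVocabWeak.{0}.IsNonDilating (tf.Φ.carrier A) (tf.Φ.pull φ))
    (hshape : tf.base.Full ∧ tf.base.Faithful ∧
      ∃ 𝒟 : D₀, ∀ Y : D₀, (∃ A : ConnectedPart (BTemp (Cu.temperedArithmeticGroup e').Pi), Nonempty (tf.base.obj A ≅ Y)) ↔
        Nonempty (Y ⟶ 𝒟))
    {N' : ℕ+} (μ' : DS.CyclotomeMod l' N') (h15 : DS.Prop15iii ES hC) (L : Cu.CuspLabels)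
    (h218i : (Cu.rigidData μ' hC hS h15 L).Cor218_i) :
    ∃ hh : Thm44Hyp
        (mkOfConnectedTemperoidYddTower (Cu.temperedArithmeticGroup e') tf hZ hP NH (Cu.thetaEnvTower τ hC hS)
          (ContinuousMulEquiv.refl _))
        (mkOfConnectedTemperoidYddTower (Cu.temperedArithmeticGroup e') tf hZ hP NH (Cu.thetaEnvTower τ hC hS)
          (ContinuousMulEquiv.refl _)),
      hh.Ψ = Ψ :=
  exists_thm44Hyp_ofThetaSettingYddTower_of_model_of_cor218_i Cu τ hC hS tf hZ hP NH Ψ (tf.hypotheses_treeCatVocab hBmon)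
    (tf.isNonDilatingOn_iff_pull_weak.mpr hndV) hndV hshape μ' h15 L h218i

end SettingTreeVocabWeak

end BiKummerSetting

end Literature.AnabelianGeometry.EtaleTheta

end
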